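import Literature.NumberTheory.EllipticCurves.IwasawaEisensteinTwistedCocycleInjectiveProofs
import Literature.NumberTheory.EllipticCurves.ZpExtensionScalarTwistFiniteProofs
import HarnessLib

/-!
# The `A_{m,k}`-twisted module `M ⊗ A_{m,k}(χ)` as a discrete `Γ_K`-module (carrier `TwistedBy χ M`):
# action `σ · w = χ(σ) · (1 ⊗ σ) w`, finiteness, open stabilisers, and NO `Gal(K̄/K_∞)`-fixed vectors

Topic `NumberTheory/EllipticCurves` (sequel to `IwasawaEisensteinTwistedCocycle{Readout,Injective}Proofs`; cell
`pub/bsd-print-x9`, blueprint HOME/p2/S1-DISCRETE-CONTROL §1(c), packaging file for the descent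
`ZpDescent.exists_resSubgroup_eq_of_conjH1_eq_of_forall_fixed_eq_zero`).  Definitions with bodies (a carrier synonym
with its instances — the only instances of the file live on this NEW carrier) and theorems; no named fact, no `sorry`.

For a monoid homomorphism `χ : Γ_K →* A_{m,k}` (the values of the inverse Eisenstein character `ψ⁻¹`,
`ψ(γ) = 1 + T`) and a `Γ_K`-module `M` (additive, `DistribMulAction`), **`TwistedBy χ M`** is the abelian group
`A_{m,k} ⊗_ℤ M` (`EisensteinCoeff.Twisted p m k M`) with the TWISTED action `σ · w := χ(σ) · (1 ⊗ σ) w`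
(`CoeffExtension.mapEnd (DistribMulAction.toAddMonoidEnd _ M σ)`), the discrete topology and its `A_{m,k}`-module
structure.  The twisted crossed homomorphisms `f(στ) = f σ + χ σ · (1⊗σ) f τ` of the cocycle files are exactly the
1-cocycles of `TwistedBy χ M` (`smul_def`).  Proved: `one_smul`/`mul_smul`/additivity (the `DistribMulAction`
instance), **`TwistedBy.eq_zero_of_forall_smul_eq`** (if `χ` is trivial on `ker κ`, `M` is killed by `p^k` and has no
non-zero `ker κ`-fixed vector then neither has `TwistedBy χ M` — read the coordinates), **`TwistedBy.isOpen_stabilizer`**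
(`χ` locally constant and the stabilisers of `M` open ⇒ the stabilisers of `TwistedBy χ M` open), `TwistedBy.finite`.
These are precisely the hypotheses `hstab`/`hfix`/`[Finite]` of the fixed-point-free descent for `TwistedBy χ M`.

References: [GreenbergLNM1716] §4 p. 107 (`A_s = E[p^∞] ⊗ κ^s` as a Galois module); [Howard2004HeegnerKolyvagin] §2.2
(`T_𝔮 = T ⊗ S_𝔮` with the diagonal action), Lemma 2.2.7 / Prop. 2.2.8; [Washington1997] §13.2.
BSD is not proved by any of this.
-/

noncomputable section

open Literature.NumberTheory.EllipticCurves Literature.NumberTheory.GaloisRepresentations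

universe u

namespace Literature.NumberTheory.EllipticCurves

namespace IwasawaAlgebra

variable {K : Type u} [Field K] {p : ℕ} [hp : Fact p.Prime] {m k : ℕ}

/-- **The carrier of `M ⊗ A_{m,k}(χ)`**: a synonym of `A_{m,k} ⊗_ℤ M` remembering the twisting character `χ`.
[cite: GreenbergLNM1716, §4 p. 107] [cite: Howard2004HeegnerKolyvagin, §2.2] -/
@[nolint unusedArguments]
def EisensteinCoeff.TwistedBy (_χ : Field.absoluteGaloisGroup K →* EisensteinCoeff p m k) (M : Type u) [AddCommGroup M] :
    Type u :=
  EisensteinCoeff.Twisted p m k M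

namespace EisensteinCoeff.TwistedBy

variable (χ : Field.absoluteGaloisGroup K →* EisensteinCoeff p m k) (M : Type u) [AddCommGroup M]

/-- The additive group structure (that of `A ⊗ M`). [cite: Howard2004HeegnerKolyvagin, §2.2] -/
instance instAddCommGroup : AddCommGroup (TwistedBy χ M) := inferInstanceAs (AddCommGroup (Twisted p m k M))

/-- The `A_{m,k}`-module structure (that of `A ⊗ M`). [cite: Howard2004HeegnerKolyvagin, §2.2] -/
instance instModule : Module (EisensteinCoeff p m k) (TwistedBy χ M) :=
  inferInstanceAs (Module (EisensteinCoeff p m k) (Twisted p m k M))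

/-- The discrete topology. [cite: SerreGaloisCohomology1997, II.§1 (discrete modules)] -/
instance instTopologicalSpace : TopologicalSpace (TwistedBy χ M) := ⊥

/-- The topology is discrete. [cite: SerreGaloisCohomology1997, II.§1 (discrete modules)] -/
instance instDiscreteTopology : DiscreteTopology (TwistedBy χ M) := ⟨rfl⟩

/-- The identity `A ⊗ M → TwistedBy χ M` (change of view). [cite: Howard2004HeegnerKolyvagin, §2.2] -/
def ofTwisted : Twisted p m k M ≃+ TwistedBy χ M := AddEquiv.refl _

variable {M} [DistribMulAction (Field.absoluteGaloisGroup K) M]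

/-- **The twisted action `σ · w = χ(σ) · (1 ⊗ σ) w`.** [cite: GreenbergLNM1716, §4 p. 107] [cite: Howard2004HeegnerKolyvagin, §2.2] -/
instance instSMul : SMul (Field.absoluteGaloisGroup K) (TwistedBy χ M) :=
  ⟨fun σ w ↦ ofTwisted χ M (χ σ • CoeffExtension.mapEnd (DistribMulAction.toAddMonoidEnd _ M σ) ((ofTwisted χ M).symm w))⟩

/-- Unfolding the twisted action. [cite: Howard2004HeegnerKolyvagin, §2.2] -/
theorem smul_def (σ : Field.absoluteGaloisGroup K) (w : TwistedBy χ M) :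
    σ • w = ofTwisted χ M (χ σ • CoeffExtension.mapEnd (DistribMulAction.toAddMonoidEnd _ M σ) ((ofTwisted χ M).symm w)) :=
  rfl

/-- The twisted action on the underlying tensor: `(ofTwisted)⁻¹ (σ · w) = χ σ • (1⊗σ) (ofTwisted⁻¹ w)`.
[cite: Howard2004HeegnerKolyvagin, §2.2] -/
theorem ofTwisted_symm_smul (σ : Field.absoluteGaloisGroup K) (w : TwistedBy χ M) :
    (ofTwisted χ M).symm (σ • w) =
      χ σ • CoeffExtension.mapEnd (DistribMulAction.toAddMonoidEnd _ M σ) ((ofTwisted χ M).symm w) :=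
  rfl

/-- **`TwistedBy χ M` is a `Γ_K`-module.** [cite: GreenbergLNM1716, §4 p. 107] [cite: Howard2004HeegnerKolyvagin, §2.2] -/
instance instDistribMulAction : DistribMulAction (Field.absoluteGaloisGroup K) (TwistedBy χ M) where
  one_smul w := by
    change ofTwisted χ M (χ 1 • CoeffExtension.mapEnd (DistribMulAction.toAddMonoidEnd _ M 1) ((ofTwisted χ M).symm w)) = w
    rw [map_one, one_smul, IwasawaDual.mapEnd_toAddMonoidEnd_one]
    rfl
  mul_smul σ τ w := by
    change ofTwisted χ M (χ (σ * τ) • CoeffExtension.mapEnd (DistribMulAction.toAddMonoidEnd _ M (σ * τ))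
        ((ofTwisted χ M).symm w)) =
      ofTwisted χ M (χ σ • CoeffExtension.mapEnd (DistribMulAction.toAddMonoidEnd _ M σ)
        ((ofTwisted χ M).symm (ofTwisted χ M (χ τ • CoeffExtension.mapEnd (DistribMulAction.toAddMonoidEnd _ M τ)
          ((ofTwisted χ M).symm w)))))
    rw [AddEquiv.symm_apply_apply, map_mul, IwasawaDual.mapEnd_toAddMonoidEnd_mul, LinearMap.map_smul, smul_smul]
  smul_zero σ := by
    change ofTwisted χ M (χ σ • CoeffExtension.mapEnd (DistribMulAction.toAddMonoidEnd _ M σ) ((ofTwisted χ M).symm 0)) = 0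
    rw [map_zero, map_zero, smul_zero, map_zero]
  smul_add σ w w' := by
    change ofTwisted χ M (χ σ • CoeffExtension.mapEnd (DistribMulAction.toAddMonoidEnd _ M σ) ((ofTwisted χ M).symm (w + w'))) =
      ofTwisted χ M (χ σ • CoeffExtension.mapEnd (DistribMulAction.toAddMonoidEnd _ M σ) ((ofTwisted χ M).symm w)) +
        ofTwisted χ M (χ σ • CoeffExtension.mapEnd (DistribMulAction.toAddMonoidEnd _ M σ) ((ofTwisted χ M).symm w'))
    rw [map_add, map_add, smul_add, map_add]

/-- **A 1-cocycle of `TwistedBy χ M` is a twisted crossed homomorphism** (the hypothesis `hf` of the cocycle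
files): `f(στ) = f σ + σ · f τ` unfolds to `f σ + χ σ · (1⊗σ) f τ` on the underlying tensors.
[cite: GreenbergLNM1716, §4 p. 107] -/
theorem twisted_of_cocycle (f : Field.absoluteGaloisGroup K → TwistedBy χ M)
    (hf : ∀ σ τ, f (σ * τ) = f σ + σ • f τ) (σ τ : Field.absoluteGaloisGroup K) :
    (ofTwisted χ M).symm (f (σ * τ)) = (ofTwisted χ M).symm (f σ) +
      χ σ • CoeffExtension.mapEnd (DistribMulAction.toAddMonoidEnd _ M σ) ((ofTwisted χ M).symm (f τ)) := by
  rw [hf, map_add, ofTwisted_symm_smul]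

variable {χ}

/-- On `σ` with `χ σ = 1` the twisted action is `1 ⊗ σ`. [cite: Howard2004HeegnerKolyvagin, §2.2] -/
theorem ofTwisted_symm_smul_of_eq_one {σ : Field.absoluteGaloisGroup K} (hσ : χ σ = 1) (w : TwistedBy χ M) :
    (ofTwisted χ M).symm (σ • w) =
      CoeffExtension.mapEnd (DistribMulAction.toAddMonoidEnd _ M σ) ((ofTwisted χ M).symm w) := by
  rw [ofTwisted_symm_smul, hσ, one_smul]

/-- **No fixed vectors transfer to the twist**: if `χ` is trivial on a subgroup `N`, `M` is killed by `p^k` and has no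
non-zero `N`-fixed vector, then `TwistedBy χ M` has no non-zero `N`-fixed vector (each coordinate `λ_k([π_j^*] · w)` of a
fixed `w` is fixed, `tailReadout_dualFamily_smul_mapEnd`). For `M = E[p^k]`, `N = Gal(K̄/K_∞)`: `E(K_∞)[p] = 0` ⇒
`(E[p^k] ⊗ A_{m,k}(ψ⁻¹))^{Gal(K̄/K_∞)} = 0`. [cite: GreenbergLNM1716, §4 p. 107] [cite: Howard2004HeegnerKolyvagin, Lemma 2.2.9 (E(K_∞)[p] = 0)] -/
theorem eq_zero_of_forall_smul_eq (hm : 1 ≤ m) (hM : ∀ a : M, (p ^ k) • a = 0) (N : Subgroup (Field.absoluteGaloisGroup K))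
    (hχN : ∀ σ ∈ N, χ σ = 1) (hfix : ∀ a : M, (∀ σ ∈ N, σ • a = a) → a = 0) (w : TwistedBy χ M)
    (hw : ∀ σ ∈ N, σ • w = w) : w = 0 := by
  have hx : (ofTwisted χ M).symm w = 0 := by
    refine EisensteinCoeff.Twisted.eq_zero_of_forall_tailReadout_dualFamily_smul_eq_zero p hm k hM _ fun j ↦
      hfix _ fun σ hσ ↦ ?_
    rw [← IwasawaDual.tailReadout_dualFamily_smul_mapEnd, ← ofTwisted_symm_smul_of_eq_one (hχN σ hσ), hw σ hσ]
  simpa using congrArg (ofTwisted χ M) hx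

omit [DistribMulAction (Field.absoluteGaloisGroup K) M] in
/-- `TwistedBy χ M` is finite for finite `M` (`m ≥ 1`). [cite: Howard2004HeegnerKolyvagin, Lemma 2.2.7] -/
theorem finite [Finite M] (hm : 1 ≤ m) : Finite (TwistedBy χ M) :=
  EisensteinCoeff.finite_twisted (p := p) (k := k) hm

/-- **Open stabilisers**: if `χ` is locally constant at `1` (`χ = 1` on an open subgroup) and the stabilisers of `M` are
open, the stabilisers of `TwistedBy χ M` are open (a pure tensor `c ⊗ a` is fixed by `stab(a) ∩ {χ = 1}`; sums by
intersections). [cite: SerreGaloisCohomology1997, II.§1 (discrete modules)] -/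
theorem isOpen_stabilizer (U : Subgroup (Field.absoluteGaloisGroup K)) (hU : IsOpen (U : Set (Field.absoluteGaloisGroup K)))
    (hχU : ∀ σ ∈ U, χ σ = 1)
    (hstab : ∀ a : M, IsOpen ((MulAction.stabilizer (Field.absoluteGaloisGroup K) a : Subgroup _) :
      Set (Field.absoluteGaloisGroup K)))
    (w : TwistedBy χ M) :
    IsOpen ((MulAction.stabilizer (Field.absoluteGaloisGroup K) w : Subgroup _) : Set (Field.absoluteGaloisGroup K)) := by
  -- it suffices to find an open subgroup fixing `w`
  suffices h : ∃ V : Subgroup (Field.absoluteGaloisGroup K), IsOpen (V : Set (Field.absoluteGaloisGroup K)) ∧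
      ∀ σ ∈ V, σ • w = w by
    obtain ⟨V, hV, hVw⟩ := h
    exact Subgroup.isOpen_mono (fun σ hσ ↦ MulAction.mem_stabilizer_iff.mpr (hVw σ hσ)) hV
  -- induction on the underlying tensor
  set x := (ofTwisted χ M).symm w with hxdef
  have hwx : w = ofTwisted χ M x := by rw [hxdef, AddEquiv.apply_symm_apply]
  rw [hwx]
  clear hwx hxdef
  induction x using EisensteinCoeff.Twisted.induction_on with
  | zero => exact ⟨U, hU, fun σ _ ↦ by rw [map_zero, smul_zero]⟩
  | tmul c a =>
    refine ⟨U ⊓ MulAction.stabilizer (Field.absoluteGaloisGroup K) a, hU.inter (hstab a), fun σ hσ ↦ ?_⟩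
    apply (ofTwisted χ M).symm.injective
    rw [ofTwisted_symm_smul_of_eq_one (hχU σ hσ.1), AddEquiv.symm_apply_apply, CoeffExtension.mapEnd_tmul]
    exact congrArg (EisensteinCoeff.Twisted.tmul c) (MulAction.mem_stabilizer_iff.mp hσ.2)
  | add x y hx hy =>
    obtain ⟨V, hV, hVx⟩ := hx
    obtain ⟨V', hV', hVy⟩ := hy
    refine ⟨V ⊓ V', hV.inter hV', fun σ hσ ↦ ?_⟩
    rw [map_add, smul_add, hVx σ hσ.1, hVy σ hσ.2]

end EisensteinCoeff.TwistedBy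

end IwasawaAlgebra

end Literature.NumberTheory.EllipticCurves
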